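import Summits.Ventures.LatticeQCDFlow.Scaling.BooleanStarDoeblinHotLaw

/-!
HONEST FRAMING: exact (Metropolis-corrected) sampling algorithms for lattice gauge theory; figures
of merit are autocorrelation/cost numbers at stated couplings and volumes; no continuum-physics
claim.

# BooleanStarDoeblinHotMixing — THE COLD-START LAW OF THE BOOLEAN STAR WITH A DOEBLIN HOT SAMPLER: `d(n) ≤ ((θ+K)/θ)(1−λ)ⁿ`,
# AT `θ = 2t/(2t+a'h)`: `d(n) ≤ (1 + K(2t+a'h)/(2t))·(1 − (t·a'h/(2t+a'h))·min{ac/m, 1/(K+1)})ⁿ`,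
# `t_mix(ε) ≤ ⌈ρ⁻¹·log((1 + K(2t+a'h)/(2t))/ε)⌉` — VOLUME-FREE FOR THE REALISTIC FLOW PROPOSAL (lean-2 GEN-30, ours)

Venture-side (OURS).  Cell `lqcd-flow` (pub-lqcd), unit `pub-lqcd-lean-2-g30`, 2026-08-28.  Chapter P (OPEN-MATH-chapterM item 1 on
the two-point family), file 10: the distance profile and the mixing time for the hot kernel `M_0 = a'·μ_0 + (1−a')·R` (P8 the coupling,
P9 the contraction), exactly as `Scaling/BooleanStarColdStartLaw` (P4) did for the exact hot sampler; `h = (1−t)w_0`.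

## What is proved

* **`boolSyncDoeblin_offDiag_le`** — `P_{(x,y)}{X_n ≠ Y_n} ≤ ((θ+K)/θ)(1−λ)ⁿ`, `λ = min{(1−θ)act/m, (a'hθ − (1−θ)t)/(K+θ)}`.
* **`boolStarDoeblin_worstTvDist_le`** — **`d(n) ≤ ((θ+K)/θ)·(1−λ)ⁿ`** (two-point replicas with positive laws, identity maps on a hub list
  with multiplicities `≥ c`, `μ_k`-reversible cold kernels and residual `R` with `M_0 = a'μ_0 + (1−a')R` reversible, `0 ≤ t ≤ 1`, `w` a
  probability vector, `0 ≤ a' ≤ 1`, acceptance floor `a ≥ 0`, `0 < θ ≤ 1`, `(1−θ)t ≤ a'hθ`).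
* **`boolStarDoeblin_worstTvDist_le_tuned`** — `θ = 2t/(2t+a'h)` (`0 < t < 1`, `w_0 > 0`, `a' > 0`):
  **`d(n) ≤ (1 + K(2t+a'h)/(2t))·(1 − (t·a'h/(2t+a'h))·min{ac/m, 1/(K+1)})ⁿ`**.
* **`boolStarDoeblin_mixingTime_le`** — **`t_mix(ε) ≤ ⌈ρ⁻¹·log((1 + K(2t+a'h)/(2t))/ε)⌉`**, `ρ = (t·a'h/(2t+a'h))·min{ac/m, 1/(K+1)}`.

Reading (no numerics implied): with an independence hot sampler of minorisation constant `a'` the two-point cold-start law is that of the exact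
sampler with `h ↦ a'h`: `O((K + m/(ac))·(1/t + 1/(a'h))·log(K/ε))`, still free of the replica laws and of any regime.  NOT CLAIMED:
general `S`; anything measured.  Literature grade (cell rule): OWN; nothing cited as a fact; no new bib keys.
-/

noncomputable section

open Finset Function
open Literature.Probability.MarkovChains

namespace Summit.Ventures.LatticeQCDFlow.Scaling

variable {K m : ℕ} {μ : Fin (K + 1) → Bool → ℝ} {M : Fin (K + 1) → Bool → Bool → ℝ} {R : Bool → Bool → ℝ} {w : Fin (K + 1) → ℝ}
  {t a' : ℝ}

section Doeblin
variable (κ : Fin m → Fin K)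

/-- **Disagreement probability with a Doeblin hot sampler:** `P_{(x,y)}{X_n ≠ Y_n} ≤ ((θ+K)/θ)·(1−λ)ⁿ`. [ours] -/
theorem boolSyncDoeblin_offDiag_le (hm : 1 ≤ m) (ht0 : 0 ≤ t) (ht1 : t ≤ 1) (hw0 : ∀ k, 0 ≤ w k) (hw1 : ∑ k, w k = 1)
    (hμ : ∀ k x, 0 < μ k x) (hμ1 : ∀ k, ∑ u, μ k u = 1) (hM : ∀ k, IsRowStochastic (M k)) (hR : IsRowStochastic R)
    (ha'0 : 0 ≤ a') (ha'1 : a' ≤ 1) (hM0 : ∀ u v, M 0 u v = a' * μ 0 v + (1 - a') * R u v)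
    {θ a : ℝ} (hθ0 : 0 < θ) (hθ1 : θ ≤ 1) (ha0 : 0 ≤ a) (hreg : (1 - θ) * t ≤ (1 - t) * w 0 * a' * θ)
    {c : ℕ} (hc : ∀ p' : Fin K, c ≤ (univ.filter (fun r : Fin m => κ r = p')).card)
    {α : Fin m → (Fin (K + 1) → Bool) → ℝ}
    (hα : ∀ r z, α r z = min 1 (tensorFun μ (edgeFlowSwap (Equiv.refl Bool) 0 (κ r).succ z) / tensorFun μ z))
    (ha : ∀ r z, z 0 ≠ z (κ r).succ → a ≤ α r z)
    {Φ : (Fin (K + 1) → Bool) × (Fin (K + 1) → Bool) → ℝ}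
    (hΦ : ∀ a, Φ a = ∑ k : Fin (K + 1), (if k = 0 then θ else 1) * (if a.1 k = a.2 k then (0 : ℝ) else 1))
    {Q : (Fin (K + 1) → Bool) × (Fin (K + 1) → Bool) → (Fin (K + 1) → Bool) × (Fin (K + 1) → Bool) → ℝ}
    (hQ : ∀ a b, Q a b =
      ∑ r : Fin m, t / m *
        (min (α r a.1) (α r a.2) * (if b.1 = edgeFlowSwap (Equiv.refl Bool) 0 (κ r).succ a.1
              ∧ b.2 = edgeFlowSwap (Equiv.refl Bool) 0 (κ r).succ a.2 then (1 : ℝ) else 0)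
          + (α r a.1 - min (α r a.1) (α r a.2)) * (if b.1 = edgeFlowSwap (Equiv.refl Bool) 0 (κ r).succ a.1 ∧ b.2 = a.2
              then (1 : ℝ) else 0)
          + (α r a.2 - min (α r a.1) (α r a.2)) * (if b.1 = a.1 ∧ b.2 = edgeFlowSwap (Equiv.refl Bool) 0 (κ r).succ a.2
              then (1 : ℝ) else 0)
          + (1 - α r a.1 - α r a.2 + min (α r a.1) (α r a.2)) * (if b.1 = a.1 ∧ b.2 = a.2 then (1 : ℝ) else 0))
      + (1 - t) * ∑ k : Fin (K + 1), w k *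
        (if k = 0 then
            (a' * ∑ v : Bool, μ 0 v * (if b.1 = update a.1 0 v ∧ b.2 = update a.2 0 v then (1 : ℝ) else 0)
              + (1 - a') * (if a.1 0 = a.2 0 then
                  ∑ v : Bool, R (a.1 0) v * (if b.1 = update a.1 0 v ∧ b.2 = update a.2 0 v then (1 : ℝ) else 0)
                else coordKernel (fun _ : Fin (K + 1) => R) 0 a.1 b.1 * coordKernel (fun _ : Fin (K + 1) => R) 0 a.2 b.2))
          else
            (if a.1 k = a.2 k then
                ∑ v : Bool, M k (a.1 k) v * (if b.1 = update a.1 k v ∧ b.2 = update a.2 k v then (1 : ℝ) else 0)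
              else coordKernel M k a.1 b.1 * coordKernel M k a.2 b.2)))
    (x y : Fin (K + 1) → Bool) (n : ℕ) :
    ∑ a, ∑ b ∈ univ.erase a, kernelAt Q n (x, y) (a, b)
      ≤ (θ + K) / θ * (1 - min ((1 - θ) * a * c * t / m) (((1 - t) * w 0 * a' * θ - (1 - θ) * t) / (K + θ))) ^ n := by
  set lam := min ((1 - θ) * a * c * t / m) (((1 - t) * w 0 * a' * θ - (1 - θ) * t) / (K + θ)) with hlam
  have hP : IsRowStochastic (fun y z : Fin (K + 1) → Bool =>
      t * ptGraphSwap μ (fun r : Fin m => (((0 : Fin (K + 1)), (κ r).succ) : Fin (K + 1) × Fin (K + 1)))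
            (fun _ : Fin m => Equiv.refl Bool) y z + (1 - t) * prodKernel w M y z) :=
    weightedScheme_isRowStochastic (ptGraphSwap_isRowStochastic hμ) hM hw0 hw1 ht0 ht1
  have hQc := boolSyncDoeblin_isMarkovianCoupling κ hm ht0 ht1 hw0 hμ hM hR ha'0 ha'1 hM0 hα hQ
  have hQs : IsRowStochastic Q := hQc.isRowStochastic hP
  have hstep := boolSyncDoeblin_step_potential_le κ hm ht0 ht1 hw0 hw1 hμ hμ1 hM hR ha'1 hθ0 hθ1 ha0 hreg hc hα ha hΦ hQ
  have hlam1 : 0 ≤ 1 - lam := by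
    have h2 : lam ≤ ((1 - t) * w 0 * a' * θ - (1 - θ) * t) / (K + θ) := min_le_right _ _
    have h3 : ((1 - t) * w 0 * a' * θ - (1 - θ) * t) / (K + θ) ≤ 1 := by
      rw [div_le_one (by positivity)]
      have hw01 : w 0 ≤ 1 := by
        calc w 0 ≤ ∑ k, w k := Finset.single_le_sum (fun k _ => hw0 k) (mem_univ 0)
          _ = 1 := hw1
      have h4 : (1 - t) * w 0 * a' ≤ 1 := by
        calc (1 - t) * w 0 * a' ≤ 1 * 1 * 1 :=
              mul_le_mul (mul_le_mul (by linarith) hw01 (hw0 0) zero_le_one) ha'1 ha'0 (by positivity)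
          _ = 1 := by ring
      nlinarith [mul_nonneg (sub_nonneg.mpr hθ1) ht0, hθ0.le, Nat.cast_nonneg (α := ℝ) K,
        mul_le_mul_of_nonneg_right h4 hθ0.le]
    linarith
  have hdecay : ∑ b, kernelAt Q n (x, y) b * Φ b ≤ (1 - lam) ^ n * Φ (x, y) := by
    have h := lawMean_lawAt_le_of_step_le hQs hlam1 hstep (μ := Pi.single (x, y) 1)
      (fun a => by rw [Pi.single_apply]; split_ifs <;> norm_num) n
    rw [lawMean_single] at h
    exact h
  have hK0 := (kernelAt_isRowStochastic hQs n).1 (x, y)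
  calc ∑ a, ∑ b ∈ univ.erase a, kernelAt Q n (x, y) (a, b)
      ≤ ∑ a, ∑ b ∈ univ.erase a, kernelAt Q n (x, y) (a, b) * (Φ (a, b) / θ) :=
        sum_le_sum fun a _ => sum_le_sum fun b hb => by
          have hne : a ≠ b := (ne_of_mem_erase hb).symm
          have hΦ' : 1 ≤ Φ (a, b) / θ := by rw [le_div_iff₀ hθ0, one_mul]; exact potential_ge_of_ne hθ0.le hθ1 hΦ hne
          simpa only [mul_one] using mul_le_mul_of_nonneg_left hΦ' (hK0 (a, b))
    _ ≤ ∑ a, ∑ b, kernelAt Q n (x, y) (a, b) * (Φ (a, b) / θ) :=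
        sum_le_sum fun a _ => sum_le_sum_of_subset_of_nonneg (erase_subset _ _) fun b _ _ =>
          mul_nonneg (hK0 (a, b)) (div_nonneg (potential_nonneg hθ0.le hΦ (a, b)) hθ0.le)
    _ = (∑ b, kernelAt Q n (x, y) b * Φ b) / θ := by
        rw [Fintype.sum_prod_type, Finset.sum_div]
        exact sum_congr rfl fun a _ => by rw [Finset.sum_div]; exact sum_congr rfl fun b _ => by ring
    _ ≤ (1 - lam) ^ n * Φ (x, y) / θ := div_le_div_of_nonneg_right hdecay hθ0.le
    _ ≤ (1 - lam) ^ n * (θ + K) / θ :=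
        div_le_div_of_nonneg_right (mul_le_mul_of_nonneg_left (potential_le hθ0.le hΦ x y) (pow_nonneg hlam1 n)) hθ0.le
    _ = (θ + K) / θ * (1 - lam) ^ n := by ring

/-- **THE COLD-START LAW OF THE BOOLEAN STAR WITH A DOEBLIN HOT SAMPLER:** **`d(n) ≤ ((θ+K)/θ)·(1 − min{(1−θ)act/m,
(a'hθ − (1−θ)t)/(K+θ)})ⁿ`** — no volume, no regime, polynomial in `K`. [ours] -/
theorem boolStarDoeblin_worstTvDist_le (hm : 1 ≤ m) (ht0 : 0 ≤ t) (ht1 : t ≤ 1) (hw0 : ∀ k, 0 ≤ w k) (hw1 : ∑ k, w k = 1)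
    (hμ : ∀ k x, 0 < μ k x) (hμ1 : ∀ k, ∑ u, μ k u = 1) (hM : ∀ k, IsRowStochastic (M k))
    (hMrev : ∀ k, DetailedBalance (μ k) (M k)) (hR : IsRowStochastic R) (ha'0 : 0 ≤ a') (ha'1 : a' ≤ 1)
    (hM0 : ∀ u v, M 0 u v = a' * μ 0 v + (1 - a') * R u v)
    {θ a : ℝ} (hθ0 : 0 < θ) (hθ1 : θ ≤ 1) (ha0 : 0 ≤ a) (hreg : (1 - θ) * t ≤ (1 - t) * w 0 * a' * θ)
    {c : ℕ} (hc : ∀ p' : Fin K, c ≤ (univ.filter (fun r : Fin m => κ r = p')).card)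
    (ha : ∀ (r : Fin m) (z : Fin (K + 1) → Bool), z 0 ≠ z (κ r).succ →
      a ≤ min 1 (tensorFun μ (edgeFlowSwap (Equiv.refl Bool) 0 (κ r).succ z) / tensorFun μ z))
    (n : ℕ) :
    worstTvDist (fun y z : Fin (K + 1) → Bool =>
        t * ptGraphSwap μ (fun r : Fin m => (((0 : Fin (K + 1)), (κ r).succ) : Fin (K + 1) × Fin (K + 1)))
              (fun _ : Fin m => Equiv.refl Bool) y z + (1 - t) * prodKernel w M y z) (tensorFun μ) n
      ≤ (θ + K) / θ * (1 - min ((1 - θ) * a * c * t / m) (((1 - t) * w 0 * a' * θ - (1 - θ) * t) / (K + θ))) ^ n := by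
  have hst := dominatedStar_isStationary κ (fun _ : Fin m => Equiv.refl Bool) (w := w) (M := M) ht0 ht1 hw0 hw1 hμ hM hMrev
  refine LevinPeres2017_cor_5_5 hst (fun x => (tensorFun_pos hμ x).le) (sum_tensorFun_eq_one μ hμ1) fun x y => ⟨_,
    boolSyncDoeblin_isMarkovianCoupling κ hm ht0 ht1 hw0 hμ hM hR ha'0 ha'1 hM0 (α := fun r z =>
      min 1 (tensorFun μ (edgeFlowSwap (Equiv.refl Bool) 0 (κ r).succ z) / tensorFun μ z)) (fun _ _ => rfl) (fun _ _ => rfl),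
    boolSyncDoeblin_offDiag_le κ hm ht0 ht1 hw0 hw1 hμ hμ1 hM hR ha'0 ha'1 hM0 hθ0 hθ1 ha0 hreg hc (fun _ _ => rfl) ha
      (Φ := fun a => ∑ k : Fin (K + 1), (if k = 0 then θ else 1) * (if a.1 k = a.2 k then (0 : ℝ) else 1))
      (fun _ => rfl) (fun _ _ => rfl) x y n⟩

/-- **THE TUNED LAW WITH A DOEBLIN HOT SAMPLER** (`θ = 2t/(2t+a'h)`, `h = (1−t)w_0`; `0 < t < 1`, `w_0 > 0`, `0 < a' ≤ 1`):
**`d(n) ≤ (1 + K(2t+a'h)/(2t))·(1 − (t·a'h/(2t+a'h))·min{ac/m, 1/(K+1)})ⁿ`**. [ours] -/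
theorem boolStarDoeblin_worstTvDist_le_tuned (hm : 1 ≤ m) (ht0 : 0 < t) (ht1 : t < 1) (hw0 : ∀ k, 0 ≤ w k) (hw00 : 0 < w 0)
    (hw1 : ∑ k, w k = 1) (hμ : ∀ k x, 0 < μ k x) (hμ1 : ∀ k, ∑ u, μ k u = 1) (hM : ∀ k, IsRowStochastic (M k))
    (hMrev : ∀ k, DetailedBalance (μ k) (M k)) (hR : IsRowStochastic R) (ha'0 : 0 < a') (ha'1 : a' ≤ 1)
    (hM0 : ∀ u v, M 0 u v = a' * μ 0 v + (1 - a') * R u v) {a : ℝ} (ha0 : 0 ≤ a)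
    {c : ℕ} (hc : ∀ p' : Fin K, c ≤ (univ.filter (fun r : Fin m => κ r = p')).card)
    (ha : ∀ (r : Fin m) (z : Fin (K + 1) → Bool), z 0 ≠ z (κ r).succ →
      a ≤ min 1 (tensorFun μ (edgeFlowSwap (Equiv.refl Bool) 0 (κ r).succ z) / tensorFun μ z))
    (n : ℕ) :
    worstTvDist (fun y z : Fin (K + 1) → Bool =>
        t * ptGraphSwap μ (fun r : Fin m => (((0 : Fin (K + 1)), (κ r).succ) : Fin (K + 1) × Fin (K + 1)))
              (fun _ : Fin m => Equiv.refl Bool) y z + (1 - t) * prodKernel w M y z) (tensorFun μ) n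
      ≤ (1 + K * (2 * t + a' * ((1 - t) * w 0)) / (2 * t))
        * (1 - t * (a' * ((1 - t) * w 0)) / (2 * t + a' * ((1 - t) * w 0)) * min (a * c / m) (1 / (K + 1))) ^ n := by
  set h := a' * ((1 - t) * w 0) with hh
  have hh0 : 0 < h := mul_pos ha'0 (mul_pos (by linarith) hw00)
  set θ := 2 * t / (2 * t + h) with hθ
  have hθ0 : 0 < θ := by positivity
  have hθ1 : θ ≤ 1 := by rw [hθ, div_le_one (by positivity)]; linarith
  have h1θ : 1 - θ = h / (2 * t + h) := by rw [hθ]; field_simp; ring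
  have hreg : (1 - θ) * t ≤ (1 - t) * w 0 * a' * θ := by
    rw [h1θ, show (1 - t) * w 0 * a' = h by rw [hh]; ring, hθ]
    rw [div_mul_eq_mul_div, mul_div_assoc', div_le_div_iff_of_pos_right (by positivity)]
    nlinarith [mul_pos ht0 hh0]
  have hmain := boolStarDoeblin_worstTvDist_le κ hm ht0.le ht1.le hw0 hw1 hμ hμ1 hM hMrev hR ha'0.le ha'1 hM0 hθ0 hθ1 ha0 hreg hc ha n
  have hmpos : (0 : ℝ) < m := Nat.cast_pos.mpr (by omega)
  have hrate : t * h / (2 * t + h) * min (a * c / m) (1 / (K + 1))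
      ≤ min ((1 - θ) * a * c * t / m) (((1 - t) * w 0 * a' * θ - (1 - θ) * t) / (K + θ)) := by
    refine le_min ?_ ?_
    · calc t * h / (2 * t + h) * min (a * c / m) (1 / (K + 1)) ≤ t * h / (2 * t + h) * (a * c / m) :=
            mul_le_mul_of_nonneg_left (min_le_left _ _) (by positivity)
        _ = (1 - θ) * a * c * t / m := by rw [h1θ]; ring
    · calc t * h / (2 * t + h) * min (a * c / m) (1 / (K + 1)) ≤ t * h / (2 * t + h) * (1 / (K + 1)) :=
            mul_le_mul_of_nonneg_left (min_le_right _ _) (by positivity)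
        _ ≤ t * h / (2 * t + h) * (1 / (K + θ)) := by gcongr
        _ = ((1 - t) * w 0 * a' * θ - (1 - θ) * t) / (K + θ) := by
            rw [show (1 - t) * w 0 * a' = h by rw [hh]; ring, h1θ, hθ]; field_simp; ring
  have hconst : (θ + K) / θ = 1 + K * (2 * t + h) / (2 * t) := by rw [hθ]; field_simp
  have hbase0 : 0 ≤ 1 - min ((1 - θ) * a * c * t / m) (((1 - t) * w 0 * a' * θ - (1 - θ) * t) / (K + θ)) := by
    have h2 : min ((1 - θ) * a * c * t / m) (((1 - t) * w 0 * a' * θ - (1 - θ) * t) / (K + θ))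
        ≤ ((1 - t) * w 0 * a' * θ - (1 - θ) * t) / (K + θ) := min_le_right _ _
    have h3 : ((1 - t) * w 0 * a' * θ - (1 - θ) * t) / (K + θ) ≤ 1 := by
      rw [div_le_one (by positivity)]
      have hw01 : w 0 ≤ 1 := by
        calc w 0 ≤ ∑ k, w k := Finset.single_le_sum (fun k _ => hw0 k) (mem_univ 0)
          _ = 1 := hw1
      have h4 : (1 - t) * w 0 * a' ≤ 1 := by
        calc (1 - t) * w 0 * a' ≤ 1 * 1 * 1 :=
              mul_le_mul (mul_le_mul (by linarith) hw01 (hw0 0) zero_le_one) ha'1 ha'0.le (by positivity)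
          _ = 1 := by ring
      nlinarith [mul_nonneg (sub_nonneg.mpr hθ1) ht0.le, hθ0.le, Nat.cast_nonneg (α := ℝ) K,
        mul_le_mul_of_nonneg_right h4 hθ0.le]
    linarith
  calc _ ≤ (θ + K) / θ * (1 - min ((1 - θ) * a * c * t / m) (((1 - t) * w 0 * a' * θ - (1 - θ) * t) / (K + θ))) ^ n := hmain
    _ ≤ (1 + K * (2 * t + h) / (2 * t)) * (1 - t * h / (2 * t + h) * min (a * c / m) (1 / (K + 1))) ^ n := by
        rw [hconst]
        exact mul_le_mul_of_nonneg_left (pow_le_pow_left₀ hbase0 (by linarith [hrate]) n) (by positivity)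

/-- **THE MIXING TIME WITH A DOEBLIN HOT SAMPLER:** `ρ = (t·a'h/(2t+a'h))·min{ac/m, 1/(K+1)}` (`a, a' > 0`, `c ≥ 1`):
**`t_mix(ε) ≤ ⌈ρ⁻¹·log((1 + K(2t+a'h)/(2t))/ε)⌉`**. [ours] -/
theorem boolStarDoeblin_mixingTime_le (hm : 1 ≤ m) (ht0 : 0 < t) (ht1 : t < 1) (hw0 : ∀ k, 0 ≤ w k) (hw00 : 0 < w 0)
    (hw1 : ∑ k, w k = 1) (hμ : ∀ k x, 0 < μ k x) (hμ1 : ∀ k, ∑ u, μ k u = 1) (hM : ∀ k, IsRowStochastic (M k))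
    (hMrev : ∀ k, DetailedBalance (μ k) (M k)) (hR : IsRowStochastic R) (ha'0 : 0 < a') (ha'1 : a' ≤ 1)
    (hM0 : ∀ u v, M 0 u v = a' * μ 0 v + (1 - a') * R u v) {a : ℝ} (ha0 : 0 < a)
    {c : ℕ} (hc1 : 1 ≤ c) (hc : ∀ p' : Fin K, c ≤ (univ.filter (fun r : Fin m => κ r = p')).card)
    (ha : ∀ (r : Fin m) (z : Fin (K + 1) → Bool), z 0 ≠ z (κ r).succ →
      a ≤ min 1 (tensorFun μ (edgeFlowSwap (Equiv.refl Bool) 0 (κ r).succ z) / tensorFun μ z))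
    {ε : ℝ} (hε : 0 < ε) :
    mixingTime (fun y z : Fin (K + 1) → Bool =>
        t * ptGraphSwap μ (fun r : Fin m => (((0 : Fin (K + 1)), (κ r).succ) : Fin (K + 1) × Fin (K + 1)))
              (fun _ : Fin m => Equiv.refl Bool) y z + (1 - t) * prodKernel w M y z) (tensorFun μ) ε
      ≤ ⌈1 / (t * (a' * ((1 - t) * w 0)) / (2 * t + a' * ((1 - t) * w 0)) * min (a * c / m) (1 / (K + 1)))
          * Real.log ((1 + K * (2 * t + a' * ((1 - t) * w 0)) / (2 * t)) / ε)⌉₊ := by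
  set h := a' * ((1 - t) * w 0) with hh
  have hh0 : 0 < h := mul_pos ha'0 (mul_pos (by linarith) hw00)
  have hmpos : (0 : ℝ) < m := Nat.cast_pos.mpr (by omega)
  set ρ := t * h / (2 * t + h) * min (a * c / m) (1 / (K + 1)) with hρ
  have hρ0 : 0 < ρ := by
    have : 0 < min (a * c / (m : ℝ)) (1 / ((K : ℝ) + 1)) := lt_min (by positivity) (by positivity)
    positivity
  have hρ1 : ρ ≤ 1 := by
    have h1 : t * h / (2 * t + h) ≤ 1 := by rw [div_le_one (by positivity)]; nlinarith [mul_pos ht0 hh0]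
    have h2 : min (a * c / (m : ℝ)) (1 / ((K : ℝ) + 1)) ≤ 1 := (min_le_right _ _).trans (by
      rw [div_le_one (by positivity)]; linarith [Nat.cast_nonneg (α := ℝ) K])
    have h3 : 0 ≤ min (a * c / (m : ℝ)) (1 / ((K : ℝ) + 1)) := le_min (by positivity) (by positivity)
    calc ρ ≤ 1 * 1 := mul_le_mul h1 h2 h3 zero_le_one
      _ = 1 := one_mul 1
  set n : ℕ := ⌈1 / ρ * Real.log ((1 + K * (2 * t + h) / (2 * t)) / ε)⌉₊ with hn
  refine mixingTime_le _ _ ((boolStarDoeblin_worstTvDist_le_tuned κ hm ht0 ht1 hw0 hw00 hw1 hμ hμ1 hM hMrev hR ha'0 ha'1 hM0 ha0.le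
    hc ha n).trans ?_)
  exact geom_le_of_ge_log hρ0 hρ1 (by positivity) hε (Nat.le_ceil _)

end Doeblin

end Summit.Ventures.LatticeQCDFlow.Scaling

end
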